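import Summits.NavierStokesRegularity.NavierStokesRegularity.Theorems.ScenarioCensusRowF1ax
import Summits.NavierStokesRegularity.NavierStokesRegularity.Theorems.TypeICertificateLadderRungZero
import Literature.Analysis.FluidPDE.BarkerPrange2020VorticityAlignmentTypeIHolds
import Literature.Analysis.FluidPDE.TypeIAncientMildTimeAnalytic
import Literature.Analysis.FluidPDE.TypeIAncientMildRescale
import Summits.NavierStokesRegularity.NavierStokesRegularity.Theorems.LocalHelicityTubeDoorFrobeniusProfileRigidityHelicalSlice
import HarnessLib
import Summits.NavierStokesRegularity.NavierStokesRegularity.Theorems.ScenarioCensusRowF1ScalingTopRows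
import Summits.NavierStokesRegularity.NavierStokesRegularity.Theorems.ScenarioCensusScrewBlowdownOffAxis
import Summits.NavierStokesRegularity.NavierStokesRegularity.Theorems.ScenarioCensusScrewBlowdownBridges

/-!
# Census row F1, the SCREW axis of the scaling / symmetry family — helical and crystal self-maps of the top read at SNAPSHOTS (cells F1hx / F1cx; floors HXF / CXF) — LINE 41 «screw-top»
# port, part 1/3: §1 objects (frame of LINES 34–40 BY NAME; `HelicalPocketAt`, `CrystalPocketAt`, the floors, the rows `Row_F1hx` / `Row_F1cx`); §2–§3 compactness, socket, Leray's
# every-time floor and the witness zoom package (LINES 37 / 39 BY NAME); §4a THE EUCLIDEAN KILLS — group generation from an angle range, the screw motions `g_θ`, analytic transport,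
# KX `eq_zero_of_helical`, KC `eq_zero_of_crystal`

Re-homed for the scenario census (typer seat ns-census-typer-1 g10; the cells F1hx / F1cx and the floors HXF / CXF are MEMBERS OF RECORD «DECIDED IN KERNEL IN FILES» of row F1
(item 87: critic idea-crit-3 g10 PASS no price tier B 12:52:23Z; ref PRE-CHECK ✓ §19.21; lead label LR2016 §10.4 / Pineau–Vicol 2607.09619); this port makes them TREE-decided):
VERBATIM PORT of ns-idea-3 LINE 41 «screw-top», `pub/ideators/ns-idea-3/lines/screw-top/line-screw-top.lean` sha16 61b2c9f392c9fdfd (1140 l., lean check rc 0, 0 sorry), split for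
the 400-line rule into `ScenarioCensusRowF1ScrewTop` (§1–§4a) → `…ScrewTopLevels` (§4b–§5) → `…ScrewTopRows` (§6–§7 + census KEYS).  Lean text VERBATIM in namespace
`…Theorems.ScenarioCensus.ScrewTop` (the line's `…Cruxes.ScenarioCensusRowF1.ScrewTopLine` re-homed); port edits: the frame restated VERBATIM by the line from LINES 34–40 (`topSet`,
`HasTypeIConstant`, `snapLevel`, `exists_fast_at`, `sqrt_mul_sq_mul`, `limitClass_compact`, `exists_level_of_limitKill`, `exists_witnessZoom_package`, `zoom_units`,
`eventually_forall_not_of_not_frequently`, `continuous_slice'`, `tendsto_eval`, `le_of_units`, `row_of_floor`) is taken BY NAME from the landed two-time-top /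
one-level-top / snapshot-top / needle-top / echo-top / scaling-top ports; the elementary `rotZ` / class lemmas the line restates are the tree's BY NAME (`rotZ_add_vec'` =
`ScrewBlowdown.rotZ_add_vec`, `rotZ_add_smul_eZ'` = `ScrewBlowdown.rotZ_add_smul_eZ` (census screw-blowdown port), `rotZ_smul_vec'` = `rotZ_smul`, `rotZ_neg_rotZ'` = `rotZ_neg_apply_rotZ`,
`continuous_rotZ`, `centre_mem` = `IsTypeIAncientMild.comp_add_right` (Literature.Analysis.FluidPDE)); `analyticAt_linIso` and `tendstoLocallyUniformly_comp_of_tendsto` (twins of lemmas in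
route-cone modules that are not imported) are not re-declared — the former's one-line proof term is inlined at its use sites; `@[conjecture]` on the residual `HelicalCollapse` (≡ `ScenarioCensus.Row_F1`, OPEN); one-line docstrings added
where missing (gate lint).  Statements untouched.

No census VALUE is moved here (row F1 stays OPEN-WITH-LINE; the members become TREE-decided by name); NS regularity is NOT proved; `Row_F1` is untouched (zero
movement, `helicalCollapse_iff_rowF1`); no summit statement is proved by this file. Lemmas that restate already-landed tree declarations are taken BY NAME (gate lint `dedup.landed`): `topSet` = `TwoTimeTop.topSet`, `HasTypeIConstant` = `OneLevelTop.HasTypeIConstant`, `snapLevel` = `SnapshotTop.snapLevel`, `exists_fast_at` = `SnapshotTop.exists_fast_at`, `sqrt_mul_sq_mul` = `SnapshotTop.sqrt_mul_sq_mul`, `limitClass_compact` = `NeedleTop.limitClass_compact`, `exists_level_of_limitKill` = `NeedleTop.exists_level_of_limitKill`, `zoom_units` = `NeedleTop.zoom_units`, `exists_witnessZoom_package` = `EchoTop.exists_witnessZoom_package`, `eventually_forall_not_of_not_frequently` = `EchoTop.eventually_forall_not_of_not_frequently`, `continuous_slice'` = `ScalingTop.continuous_slice'`, `tendsto_eval`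 = `ScalingTop.tendsto_eval`, `le_of_units` = `ScalingTop.le_of_units`, `row_of_floor` = `ScalingTop.row_of_floor`, `centre_mem` = `IsTypeIAncientMild.comp_add_right`, `rotZ_add_vec'` = `ScrewBlowdown.rotZ_add_vec`, `rotZ_smul_vec'` = `rotZ_smul`, `rotZ_add_smul_eZ'` = `ScrewBlowdown.rotZ_add_smul_eZ`, `rotZ_neg_rotZ'` = `rotZ_neg_apply_rotZ`.
-/

-- the summit and its single problem share the name `NavierStokesRegularity` (D-0017 nested layout)
set_option linter.dupNamespace false

noncomputable section

open MeasureTheory Set Function Filter TopologicalSpace Metric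
open scoped Topology NNReal ENNReal InnerProductSpace

namespace Summit.NavierStokesRegularity.NavierStokesRegularity.Theorems.ScenarioCensus.ScrewTop

open Literature.Analysis Literature.Analysis.FluidPDE
open Summit.NavierStokesRegularity.NavierStokesRegularity.Theorems
open Summit.NavierStokesRegularity.NavierStokesRegularity.Theses
open Summit.NavierStokesRegularity.NavierStokesRegularity.Theorems.LocalHelicityTubeDoorFrobeniusProfileRigidityHelicalSlice

/-- `ℝ³`. -/
abbrev E3 := EuclideanSpace ℝ (Fin 3)

/-! ## §1 Objects: top, dimensionless Type-I constant, Leray's level `c_S` (frame, verbatim); the EUCLIDEAN read-outs (a HELICAL pocket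
over a range of angles; a CRYSTAL pocket for one rigid motion of finite rotational order with non-zero intrinsic translation); floors, rows -/

-- `topSet`: the line restates the tree's `TwoTimeTop.topSet`; taken BY NAME (gate lint dedup.landed).

-- `HasTypeIConstant`: the line restates the tree's `OneLevelTop.HasTypeIConstant`; taken BY NAME (gate lint dedup.landed).

-- `snapLevel`: the line restates the tree's `SnapshotTop.snapLevel`; taken BY NAME (gate lint dedup.landed).

/-- **A HELICAL POCKET at the instant `t` about the point `x`** (frame `L` — a linear isometry of `ℝ³` carrying the `x₂`-axis to the
direction of the screw axis —, PITCH `h` (axial advance `h ℓ` per radian), angle range `[θ₁, θ₂]`, apex reach `A`, radius `a`, threshold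
`ε`; parabolic unit `ℓ = √(ν(T − t))`, speed unit `√ν/√(T − t)`): there is an APEX `x_* = x + ℓ b`, `‖b‖ ≤ A`, such that on the pocket of
radius `a ℓ` about `x_*` the SNAPSHOT at the instant `t` is — to dimensionless accuracy `ε` — EQUIVARIANT UNDER THE SCREW MOTIONS of pitch
`h` about the axis `x_* + ℓ L(ℝ e₂)` through EVERY angle `θ ∈ [θ₁, θ₂]`:
`√(T − t) ‖L⁻¹ u(t, x_* + ℓ L(R_θ w + hθ e₂)) − R_θ L⁻¹ u(t, x_* + ℓ L w)‖ ≤ ε √ν` for `‖w‖ ≤ a`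
(`R_θ = rotZ θ`, `e₂ = eZ`, KNSS's rotation about the `x₂`-axis and its unit vector).  NOTHING is asked to be small, slow or swirl-free —
a uniform stream along the axis, and the genuinely helical snapshot `y ↦ R_{y₂/h} e₀` (constant speed, rotating with height), satisfy it
with `ε = 0` for every angle (`helicalPocketAt_of_stream`, `helix_equivariant`).  PITCH `h = 0` (equivariance under pure ROTATIONS about
one axis over a range of angles = an AXISYMMETRIC-WITH-SWIRL pocket) is deliberately NOT a cell of this line: its kill would need the
triviality of a member of `𝒦_M` with one axisymmetric-with-swirl slice, which is covered neither by KNSS 2009 Thm 5.3 (space weight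
`|W| ≤ C/r`; tree `KNSS2009_liouville_bound_C_over_r_holds`) nor by the swirl-free theorem, falls under the KNSS conjecture on bounded
ancient axisymmetric mild solutions (open), and is not supplied by the print exclusion of axisymmetric Type-I blow-up (Seregin–Šverák
2009), which uses the local-energy structure of an axisymmetric SOLUTION up to the blow-up time — see the module docstring. -/
def HelicalPocketAt (ν T : ℝ) (u : ℝ → E3 → E3) (L : E3 ≃ₗᵢ[ℝ] E3) (h θ₁ θ₂ A a ε t : ℝ) (x : E3) : Prop :=
  ∃ b : E3, ‖b‖ ≤ A ∧ ∀ θ ∈ Icc θ₁ θ₂, ∀ w : E3, ‖w‖ ≤ a →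
    Real.sqrt (T - t) * ‖L.symm (u t (x + (Real.sqrt (ν * (T - t))) • (b + L (rotZ θ w + (h * θ) • eZ))))
      - rotZ θ (L.symm (u t (x + (Real.sqrt (ν * (T - t))) • (b + L w))))‖ ≤ ε * Real.sqrt ν

/-- **A CRYSTAL POCKET at the instant `t` about the point `x`** for ONE rigid motion `g(y) = L y + d` written in apex coordinates (`L` a
linear isometry — the rotational / reflectional part —, `d` the translation part; apex reach `A`, radius `a`, threshold `ε`): there is an
apex `x_* = x + ℓ b`, `‖b‖ ≤ A`, such that on the pocket of radius `a ℓ` about `x_*` the snapshot at the instant `t` is, to accuracy `ε`,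
EQUIVARIANT UNDER `g`:  `√(T − t) ‖u(t, x_* + ℓ (L w + d)) − L u(t, x_* + ℓ w)‖ ≤ ε √ν` for `‖w‖ ≤ a`.  The cells of this line are the
CRYSTALLOGRAPHIC motions with NON-ZERO INTRINSIC TRANSLATION: `L` of finite order (`L^[n] = id`, `n ≥ 1`: a rotation by a rational angle
`2πp/n`, a reflection, a rotary reflection) and `d ≠ 0` FIXED by `L` (`L d = d`: the translation is ALONG the axis / IN the mirror) — a
screw motion by a rational angle, a GLIDE REFLECTION (`n = 2`), …; ONE such motion suffices.  A pure point-group element (`d = 0`: an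
`n`-fold rotational or a mirror symmetry of the snapshot) and a screw by an IRRATIONAL angle are NOT cells (no kill is known; the first
contains the axisymmetric scenario in the limit `n → ∞`, the second zooms out to it). -/
def CrystalPocketAt (ν T : ℝ) (u : ℝ → E3 → E3) (L : E3 ≃ₗᵢ[ℝ] E3) (d : E3) (A a ε t : ℝ) (x : E3) : Prop :=
  ∃ b : E3, ‖b‖ ≤ A ∧ ∀ w : E3, ‖w‖ ≤ a →
    Real.sqrt (T - t) * ‖u t (x + (Real.sqrt (ν * (T - t))) • (b + (L w + d)))
      - L (u t (x + (Real.sqrt (ν * (T - t))) • (b + w)))‖ ≤ ε * Real.sqrt ν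

/-- **THE HELICAL FLOOR** (structural theorem for EVERY Clay solution with a dimensionless Type-I constant `M`; PROVED, `helicalFloor_holds`):
for every level `Λ > 0`, frame `L`, pitch `h ≠ 0`, angle range `θ₁ < θ₂`, reach `A` and radius `a > 0` there is
`ε = ε(M, Λ, L, h, θ₁, θ₂, A, a) > 0` such that, for all instants `t < T` close enough to `T`, NO `Λ`-fast point has an `ε`-helical pocket
with these parameters.  (No maximality / blow-up hypothesis; the quantifier over fast points is UNIVERSAL.) -/
def HelicalFloor : Prop :=
  ∀ (M Λ : ℝ) (L : E3 ≃ₗᵢ[ℝ] E3) (h θ₁ θ₂ A a : ℝ), 0 < Λ → h ≠ 0 → θ₁ < θ₂ → 0 < a → ∃ ε : ℝ, 0 < ε ∧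
    ∀ (ν T : ℝ), 0 < ν → 0 < T → ∀ (u : ℝ → E3 → E3) (p : ℝ → E3 → ℝ),
    IsClassicalNSSolutionOn (Ico 0 T) ν 0 u p → IsLerayHopfOn T ν 0 (u 0) u →
    HasRapidSpatialDecay (u 0) → OneLevelTop.HasTypeIConstant ν T M u →
    ∀ᶠ t in 𝓝[<] T, ∀ x ∈ TwoTimeTop.topSet ν T u Λ t, ¬ HelicalPocketAt ν T u L h θ₁ θ₂ A a ε t x

/-- **THE CRYSTAL FLOOR** (PROVED, `crystalFloor_holds`): for every level `Λ > 0`, linear isometry `L` of finite order (`L^[n] = id`,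
`n ≥ 1`), translation part `d ≠ 0` with `L d = d`, reach `A` and radius `a > 0` there is `ε > 0` such that eventually NO `Λ`-fast point
has an `ε`-crystal pocket for the rigid motion `y ↦ L y + d`. -/
def CrystalFloor : Prop :=
  ∀ (M Λ : ℝ) (L : E3 ≃ₗᵢ[ℝ] E3) (d : E3) (n : ℕ) (A a : ℝ), 0 < Λ → d ≠ 0 → L d = d → 0 < n → (∀ z : E3, (⇑L)^[n] z = z) →
    0 < a → ∃ ε : ℝ, 0 < ε ∧
    ∀ (ν T : ℝ), 0 < ν → 0 < T → ∀ (u : ℝ → E3 → E3) (p : ℝ → E3 → ℝ),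
    IsClassicalNSSolutionOn (Ico 0 T) ν 0 u p → IsLerayHopfOn T ν 0 (u 0) u →
    HasRapidSpatialDecay (u 0) → OneLevelTop.HasTypeIConstant ν T M u →
    ∀ᶠ t in 𝓝[<] T, ∀ x ∈ TwoTimeTop.topSet ν T u Λ t, ¬ CrystalPocketAt ν T u L d A a ε t x

/-- **ROW F1hx «HELICAL POCKETS»** (Type I · no symmetry · Clay class; census shape; PROVED, `rowF1hx_holds`, a corollary of the floor at
Leray's level `c_S`): for every `M`, frame `L`, pitch `h ≠ 0`, angle range `θ₁ < θ₂`, reach `A`, radius `a > 0` there is `ε > 0` such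
that: if along SOME sequence of instants `t_k ↑ T` every `c_S`-fast point has an `ε`-helical pocket, the solution extends smoothly past `T`. -/
def Row_F1hx : Prop :=
  ∀ (M : ℝ) (L : E3 ≃ₗᵢ[ℝ] E3) (h θ₁ θ₂ A a : ℝ), h ≠ 0 → θ₁ < θ₂ → 0 < a → ∃ ε : ℝ, 0 < ε ∧
    ∀ (ν T : ℝ), 0 < ν → 0 < T → ∀ (u : ℝ → E3 → E3) (p : ℝ → E3 → ℝ),
    IsClassicalNSSolutionOn (Ico 0 T) ν 0 u p → IsLerayHopfOn T ν 0 (u 0) u →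
    HasRapidSpatialDecay (u 0) → OneLevelTop.HasTypeIConstant ν T M u →
    (∃ᶠ t in 𝓝[<] T, ∀ x ∈ TwoTimeTop.topSet ν T u SnapshotTop.snapLevel t, HelicalPocketAt ν T u L h θ₁ θ₂ A a ε t x) →
    HasSmoothExtensionPast ν 0 u T

/-- **ROW F1cx «CRYSTAL POCKETS»** (Type I · no symmetry · Clay class; PROVED, `rowF1cx_holds`): for every `M`, linear isometry `L` of
finite order, translation part `d ≠ 0` fixed by `L`, reach `A`, radius `a > 0` there is `ε > 0` such that: if along some `t_k ↑ T` every
`c_S`-fast point has an `ε`-crystal pocket for `y ↦ L y + d`, the solution extends smoothly past `T`. -/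
def Row_F1cx : Prop :=
  ∀ (M : ℝ) (L : E3 ≃ₗᵢ[ℝ] E3) (d : E3) (n : ℕ) (A a : ℝ), d ≠ 0 → L d = d → 0 < n → (∀ z : E3, (⇑L)^[n] z = z) → 0 < a →
    ∃ ε : ℝ, 0 < ε ∧
    ∀ (ν T : ℝ), 0 < ν → 0 < T → ∀ (u : ℝ → E3 → E3) (p : ℝ → E3 → ℝ),
    IsClassicalNSSolutionOn (Ico 0 T) ν 0 u p → IsLerayHopfOn T ν 0 (u 0) u →
    HasRapidSpatialDecay (u 0) → OneLevelTop.HasTypeIConstant ν T M u →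
    (∃ᶠ t in 𝓝[<] T, ∀ x ∈ TwoTimeTop.topSet ν T u SnapshotTop.snapLevel t, CrystalPocketAt ν T u L d A a ε t x) →
    HasSmoothExtensionPast ν 0 u T

/-! ## §2 COMPACTNESS of `𝒦_M` (values pointwise AND locally uniformly on slices, gradients pointwise) and the SOCKET LEMMA

`𝒦_M` = `IsTypeIAncientMild M`.  The tree's extraction theorem `exists_tendsto_of_typeI_seq_Ioo` (KNSS 2009, Lemma 6.1) fed with
MEMBERS of `𝒦_M` is the sequential compactness of `𝒦_M` (values pointwise and locally uniformly on slices, gradients pointwise;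
LINES 36–39 VERBATIM).  A SCALING read-out is evaluated at points `b_j + λ•w` that MOVE with the apex `b_j` of the zoom, so this line
uses the LOCALLY UNIFORM clause (as LINE 38 did for its moving stars): after a further compactness step on the apex, a locally uniformly
convergent sequence of slices is evaluated along convergent sequences of points (`TendstoLocallyUniformly.tendsto_comp`). -/

-- `limitClass_compact`: the line restates the tree's `NeedleTop.limitClass_compact`; taken BY NAME (gate lint dedup.landed).

-- `tendstoLocallyUniformly_comp_of_tendsto`: a statement-twin of the landed `AdaptedFrequencyTangentFlowTransfer.tendstoLocallyUniformly_comp_of_tendsto` (whose module imports a route file and is therefore NOT imported here; gate lint dedup.landed); not re-declared — unused below (LINE 40's `tendsto_eval` is taken BY NAME).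

-- `exists_level_of_limitKill`: the line restates the tree's `NeedleTop.exists_level_of_limitKill`; taken BY NAME (gate lint dedup.landed).

/-! ## §3 Leray's EVERY-TIME floor (for the census rows) and the WITNESS ZOOM PACKAGE (LINE 39 VERBATIM: zooms centred at GIVEN fast points)

LINES 36–38 centred their zooms at `c_S`-fast points supplied by Leray's every-time lower rate under NON-extension (`SnapshotTop.exists_fast_at`,
kept here for the census-shaped rows).  THE WITNESS PACKAGE below instead takes the centres FROM THE HYPOTHESIS: if frequently as
`t ↑ T` there is a `Λ`-fast point `x` with a property `Q t x`, the zooms centred at such `(t_j, x_j)` converge in `𝒦_M` (SAME `M`) to a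
limit with `‖W(−1, 0)‖ ≥ Λ` — for ANY level `Λ`, with NO maximality hypothesis (the Type-I window alone runs the tree's zoom lemmas
`zoom_continuousOn` / `zoom_isWeaklyDivFree` / `zoom_oseen` / `zoom_norm_le` and the extraction `exists_tendsto_of_typeI_seq_Ioo`).
This is what makes the floors UNIVERSAL over fast points (every `Λ`-fast point fails the scaling read-out), where LINES 36–38 could
only say that SOME `c_S`-fast point fails to be calm. -/

-- `exists_fast_at`: the line restates the tree's `SnapshotTop.exists_fast_at`; taken BY NAME (gate lint dedup.landed).

-- `sqrt_mul_sq_mul`: the line restates the tree's `SnapshotTop.sqrt_mul_sq_mul`; taken BY NAME (gate lint dedup.landed).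

-- `exists_witnessZoom_package`: the line restates the tree's `EchoTop.exists_witnessZoom_package`; taken BY NAME (gate lint dedup.landed).

/-! ## §4 THE EUCLIDEAN KILLS (new) — GROUP GENERATION from an angle range, point continuation, and the tree's Liouville theorems for
the SCREW and CRYSTALLOGRAPHIC symmetries of ONE slice BY NAME

Both kills run on `𝒦_M` and end in a tree theorem quoted BY NAME:
* (KX) HELICAL pocket over a RANGE of angles `θ ∈ [θ₁, θ₂]` (pitch `h ≠ 0`, any frame, any apex) ⇒ `W ≡ 0`: extend the relation in the
  POINT (analytic slices, identity theorem on `ℝ³`) and then in the ANGLE — by GROUP GENERATION, not by analyticity: the screw motions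
  `g_θ y = R_θ y + hθ e₂` form a one-parameter group (`screw_add`), the set of angles `θ` for which the slice is `g_θ`-equivariant is
  therefore a SUBGROUP of `ℝ`, and a subgroup containing an interval of positive length is `ℝ` (`screw_all_angles`: Archimedes) —
  and quote `LocalHelicityTubeDoorFrobeniusProfileRigidityHelicalSlice.eq_zero_of_helical_slice_anyAxis` (ONE helically symmetric slice of
  pitch `≠ 0` ⇒ trivial: `θ = 2π` exhibits a spatial period `2πh e₂ ≠ 0`, and a periodic slice of a `|s|^{−1/2}`-decaying Oseen-mild
  profile vanishes by energy decay on the period cell + backward uniqueness).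
* (KC) CRYSTAL pocket for ONE rigid motion `y ↦ L y + d` with `L^[n] = id`, `d ≠ 0`, `L d = d` ⇒ `W ≡ 0`: extend in the point and quote
  `LocalHelicityTubeDoorFrobeniusProfileRigidityHelicalSlice.eq_zero_of_discreteScrew_slice` (the `n`-th iterate of the motion is the
  translation by `n d ≠ 0`).  ONE element suffices here — contrast LINE 40, where one scaling factor is the open DSS scenario. -/

-- `centre_mem`: the line restates the tree's `IsTypeIAncientMild.comp_add_right`; taken BY NAME (gate lint dedup.landed).

-- `continuous_slice'`: the line restates the tree's `ScalingTop.continuous_slice'`; taken BY NAME (gate lint dedup.landed).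

/-! ### The rotation `R_θ` as a continuous linear map; the screw motions `g_θ = R_θ + hθ e₂` as a one-parameter group -/

-- `rotZ_add_vec'`: the line restates the tree's `ScrewBlowdown.rotZ_add_vec`; taken BY NAME (gate lint dedup.landed).

-- `rotZ_smul_vec'`: the line restates the tree's `rotZ_smul`; taken BY NAME (gate lint dedup.landed).

-- `rotZ_add_smul_eZ'`: the line restates the tree's `ScrewBlowdown.rotZ_add_smul_eZ`; taken BY NAME (gate lint dedup.landed).

/-- `R_θ` as a linear map of `ℝ³`. -/
def rotLin (θ : ℝ) : E3 →ₗ[ℝ] E3 where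
  toFun := rotZ θ
  map_add' := ScrewBlowdown.rotZ_add_vec θ
  map_smul' := rotZ_smul θ

/-- `R_θ` as a continuous linear map of `ℝ³` (finite dimension). -/
def rotCLM (θ : ℝ) : E3 →L[ℝ] E3 := LinearMap.toContinuousLinearMap (rotLin θ)

/-- `rotCLM θ` is `rotZ θ` as a function. -/
theorem coe_rotCLM (θ : ℝ) : (⇑(rotCLM θ) : E3 → E3) = rotZ θ := rfl

-- `continuous_rotZ`: the line restates the tree's `Literature.Analysis.FluidPDE.continuous_rotZ` (KNSSTypeIIProofs, in the import closure and opened); taken BY NAME (gate lint dedup.landed).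

/-- `R_θ` is real-analytic (it is linear). -/
theorem analyticAt_rotZ (θ : ℝ) (y : E3) : AnalyticAt ℝ (rotZ θ) y := by
  rw [← coe_rotCLM]
  exact (rotCLM θ).analyticAt y

-- `analyticAt_linIso`: a statement-twin of the landed `PeepholeEchoDoorTwisted.analyticAt_linearIsometryEquiv` (route-cone module, NOT imported); not re-declared — its one-line proof term `(L.toContinuousLinearEquiv : E3 →L[ℝ] E3).analyticAt _` is inlined at the four use sites.

/-- The **screw motion** of pitch `h` through the angle `θ` about the `x₂`-axis: `g_θ y = R_θ y + hθ e₂`. -/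
def screw (h θ : ℝ) (y : E3) : E3 := rotZ θ y + (h * θ) • eZ

/-- Unfolding of `screw`. -/
theorem screw_def (h θ : ℝ) (y : E3) : screw h θ y = rotZ θ y + (h * θ) • eZ := rfl

/-- The screw motions of a fixed pitch form a ONE-PARAMETER GROUP: `g_{α+β} = g_α ∘ g_β`. -/
theorem screw_add (h α β : ℝ) (y : E3) : screw h (α + β) y = screw h α (screw h β y) := by
  rw [screw, screw, screw, ScrewBlowdown.rotZ_add_smul_eZ, ← rotZ_add, mul_add, add_smul]
  abel

/-- The screw motion at angle `0` is the identity. -/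
@[simp] theorem screw_zero (h : ℝ) (y : E3) : screw h 0 y = y := by
  simp [screw]

-- `rotZ_neg_rotZ'`: the line restates the tree's `rotZ_neg_apply_rotZ`; taken BY NAME (gate lint dedup.landed).

/-- `g_θ ∘ g_{−θ} = id`. -/
theorem screw_screw_neg (h θ : ℝ) (y : E3) : screw h θ (screw h (-θ) y) = y := by
  rw [← screw_add, add_neg_cancel, screw_zero]

/-- The screw motion is real-analytic in the point. -/
theorem analyticAt_screw (h θ : ℝ) (y : E3) : AnalyticAt ℝ (screw h θ) y :=
  (analyticAt_rotZ θ y).add analyticAt_const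

/-- **ANGLE CONTINUATION BY GROUP GENERATION (the new move).**  If a map `V : ℝ³ → ℝ³` is equivariant under the screw motions of pitch
`h` for all angles of a non-degenerate interval, `V (g_θ y) = R_θ (V y)` for `θ ∈ [θ₁, θ₂]`, `θ₁ < θ₂`, then it is equivariant for
EVERY angle `θ ∈ ℝ`: the set of good angles is closed under addition (`screw_add`, `rotZ_add`) and negation, contains
`[0, θ₂ − θ₁]`, hence every `[0, nδ]` (induction) and all of `ℝ` (Archimedes).  No analyticity in the angle is used. -/
theorem screw_all_angles {V : E3 → E3} {h θ₁ θ₂ : ℝ} (h12 : θ₁ < θ₂)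
    (hV : ∀ θ ∈ Icc θ₁ θ₂, ∀ y : E3, V (screw h θ y) = rotZ θ (V y)) :
    ∀ (θ : ℝ) (y : E3), V (screw h θ y) = rotZ θ (V y) := by
  have hcomp : ∀ α β : ℝ, (∀ y, V (screw h α y) = rotZ α (V y)) → (∀ y, V (screw h β y) = rotZ β (V y)) →
      ∀ y, V (screw h (α + β) y) = rotZ (α + β) (V y) := by
    intro α β hα hβ y
    rw [screw_add, hα, hβ, ← rotZ_add]
  have hinv : ∀ α : ℝ, (∀ y, V (screw h α y) = rotZ α (V y)) → ∀ y, V (screw h (-α) y) = rotZ (-α) (V y) := by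
    intro α hα y
    have e := hα (screw h (-α) y)
    rw [screw_screw_neg] at e
    rw [e, rotZ_neg_apply_rotZ]
  set δ : ℝ := θ₂ - θ₁ with hδ
  have hδpos : 0 < δ := by rw [hδ]; exact sub_pos.2 h12
  have h0 : ∀ φ ∈ Icc 0 δ, ∀ y, V (screw h φ y) = rotZ φ (V y) := by
    intro φ hφ
    have e : φ = (θ₁ + φ) + (-θ₁) := by ring
    rw [e]
    exact hcomp _ _ (hV (θ₁ + φ) ⟨by linarith [hφ.1], by rw [hδ] at hφ; linarith [hφ.2]⟩)
      (hinv _ (hV θ₁ ⟨le_rfl, h12.le⟩))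
  have hn : ∀ n : ℕ, ∀ φ ∈ Icc 0 (((n : ℝ) + 1) * δ), ∀ y, V (screw h φ y) = rotZ φ (V y) := by
    intro n
    induction n with
    | zero =>
      intro φ hφ
      exact h0 φ ⟨hφ.1, by simpa using hφ.2⟩
    | succ n ih =>
      intro φ hφ
      by_cases hle : φ ≤ ((n : ℝ) + 1) * δ
      · exact ih φ ⟨hφ.1, hle⟩
      · have e : φ = (φ - δ) + δ := by ring
        rw [e]
        push Not at hle
        have hnn : (0 : ℝ) ≤ (n : ℝ) * δ := mul_nonneg (Nat.cast_nonneg n) hδpos.le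
        have h2 : φ ≤ ((n : ℝ) + 1 + 1) * δ := by have := hφ.2; push_cast at this; linarith
        refine hcomp _ _ (ih (φ - δ) ⟨by nlinarith, by nlinarith⟩) (h0 δ ⟨hδpos.le, le_rfl⟩)
  intro θ y
  rcases le_or_gt 0 θ with hθ | hθ
  · obtain ⟨n, hnθ⟩ := exists_nat_ge (θ / δ)
    have hle : θ ≤ ((n : ℝ) + 1) * δ := by
      rw [div_le_iff₀ hδpos] at hnθ
      nlinarith
    exact hn n θ ⟨hθ, hle⟩ y
  · obtain ⟨n, hnθ⟩ := exists_nat_ge (-θ / δ)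
    have hle : -θ ≤ ((n : ℝ) + 1) * δ := by
      rw [div_le_iff₀ hδpos] at hnθ
      nlinarith
    have hgood := hn n (-θ) ⟨by linarith, hle⟩
    have := hinv (-θ) hgood y
    simpa using this

/-- The slice transported to the apex frame, `y ↦ L⁻¹ W(−1, L y + b)`, is real-analytic. -/
theorem analyticAt_transport {M : ℝ} {W : ℝ → E3 → E3} (hW : IsTypeIAncientMild M W) (L : E3 ≃ₗᵢ[ℝ] E3) (b y : E3) :
    AnalyticAt ℝ (fun y : E3 => L.symm (W (-1) (L y + b))) y := by
  have hslice : AnalyticOnNhd ℝ (W (-1)) univ := hW.analyticOnNhd_slice_univ (by norm_num)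
  have h1 : AnalyticAt ℝ (fun y : E3 => L y + b) y := ((L.toContinuousLinearEquiv : E3 →L[ℝ] E3).analyticAt y).fun_add analyticAt_const
  have h2 : AnalyticAt ℝ (fun y : E3 => W (-1) (L y + b)) y :=
    AnalyticAt.comp (g := W (-1)) (f := fun y : E3 => L y + b) (x := y) (hslice _ (mem_univ _)) h1
  exact AnalyticAt.comp (g := fun z : E3 => L.symm z) (f := fun y : E3 => W (-1) (L y + b)) (x := y)
    ((L.symm.toContinuousLinearEquiv : E3 →L[ℝ] E3).analyticAt _) h2

/-- **(KX) A HELICAL POCKET OVER A RANGE OF ANGLES KILLS.**  `W ∈ 𝒦_M`, a frame `L`, an apex `b`, pitch `h ≠ 0`, angles `θ₁ < θ₂`,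
`a > 0`, and `L⁻¹ W(−1, b + L(R_θ w + hθ e₂)) = R_θ L⁻¹ W(−1, b + L w)` for `θ ∈ [θ₁, θ₂]`, `‖w‖ < a` (the snapshot is helically
equivariant about the axis through `b` directed by `L e₂`, with pitch `h`, for a range of angles).  Then `W ≡ 0` (point continuation +
group generation + tree `eq_zero_of_helical_slice_anyAxis` BY NAME). -/
theorem eq_zero_of_helical {M : ℝ} {W : ℝ → E3 → E3} (hW : IsTypeIAncientMild M W) (L : E3 ≃ₗᵢ[ℝ] E3) (b : E3)
    {h θ₁ θ₂ a : ℝ} (hh : h ≠ 0) (h12 : θ₁ < θ₂) (ha : 0 < a)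
    (hhel : ∀ θ ∈ Icc θ₁ θ₂, ∀ w ∈ ball (0 : E3) a,
      L.symm (W (-1) (b + L (rotZ θ w + (h * θ) • eZ))) = rotZ θ (L.symm (W (-1) (b + L w)))) :
    ∀ s < 0, ∀ y : E3, W s y = 0 := by
  set V : E3 → E3 := fun y => L.symm (W (-1) (L y + b)) with hVdef
  have hall : ∀ θ ∈ Icc θ₁ θ₂, ∀ y : E3, V (screw h θ y) = rotZ θ (V y) := by
    intro θ hθ
    have hf : AnalyticOnNhd ℝ (fun y : E3 => V (screw h θ y)) univ := fun y _ =>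
      AnalyticAt.comp (g := V) (f := screw h θ) (x := y) (analyticAt_transport hW L b _) (analyticAt_screw h θ y)
    have hg : AnalyticOnNhd ℝ (fun y : E3 => rotZ θ (V y)) univ := fun y _ =>
      AnalyticAt.comp (g := rotZ θ) (f := V) (x := y) (analyticAt_rotZ θ _) (analyticAt_transport hW L b y)
    have hev : (fun y : E3 => V (screw h θ y)) =ᶠ[𝓝 (0 : E3)] fun y => rotZ θ (V y) := by
      filter_upwards [isOpen_ball.mem_nhds (mem_ball_self ha)] with w hw
      simp only [hVdef, screw]
      rw [add_comm (L (rotZ θ w + (h * θ) • eZ)) b, add_comm (L w) b]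
      exact hhel θ hθ w hw
    have heq := hf.eqOn_of_preconnected_of_eventuallyEq hg isPreconnected_univ (mem_univ 0) hev
    exact fun y => heq (mem_univ y)
  have hθall := screw_all_angles h12 hall
  exact eq_zero_of_helical_slice_anyAxis hW.hasTypeITimeDecay hW.continuousOn_uncurry
    (fun s t hst ht x => hW.mild_eq_heatExtension hst ht x) (fun t ht => hW.isDivFree ht) L b
    (show (-1 : ℝ) < 0 by norm_num) hh (fun θ y => hθall θ y)

/-- **(KC) ONE CRYSTALLOGRAPHIC SELF-MAP WITH NON-ZERO INTRINSIC TRANSLATION KILLS.**  `W ∈ 𝒦_M`, an apex `b`, a linear isometry `L`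
of finite order (`L^[n] = id`, `n ≥ 1`), a translation part `d ≠ 0` with `L d = d`, `a > 0`, and `W(−1, b + (L w + d)) = L W(−1, b + w)`
for `‖w‖ < a`.  Then `W ≡ 0` (point continuation + tree `eq_zero_of_discreteScrew_slice` BY NAME, applied to the re-centred member). -/
theorem eq_zero_of_crystal {M : ℝ} {W : ℝ → E3 → E3} (hW : IsTypeIAncientMild M W) (b : E3) (L : E3 ≃ₗᵢ[ℝ] E3) {d : E3}
    (hd : d ≠ 0) (hfix : L d = d) {n : ℕ} (hn : 0 < n) (hLn : ∀ z : E3, (⇑L)^[n] z = z) {a : ℝ} (ha : 0 < a)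
    (hsym : ∀ w ∈ ball (0 : E3) a, W (-1) (b + (L w + d)) = L (W (-1) (b + w))) :
    ∀ s < 0, ∀ y : E3, W s y = 0 := by
  have hV : IsTypeIAncientMild M (fun s y => W s (y + b)) := IsTypeIAncientMild.comp_add_right hW b
  have hslice : AnalyticOnNhd ℝ (fun y : E3 => W (-1) (y + b)) univ := hV.analyticOnNhd_slice_univ (by norm_num)
  have hf : AnalyticOnNhd ℝ (fun y : E3 => W (-1) (L y + d + b)) univ := fun y _ =>
    AnalyticAt.comp (g := fun z : E3 => W (-1) (z + b)) (f := fun y : E3 => L y + d) (x := y)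
      (hslice _ (mem_univ _)) (((L.toContinuousLinearEquiv : E3 →L[ℝ] E3).analyticAt y).fun_add analyticAt_const)
  have hg : AnalyticOnNhd ℝ (fun y : E3 => L (W (-1) (y + b))) univ := fun y _ =>
    AnalyticAt.comp (g := fun z : E3 => L z) (f := fun y : E3 => W (-1) (y + b)) (x := y)
      ((L.toContinuousLinearEquiv : E3 →L[ℝ] E3).analyticAt _) (hslice y (mem_univ _))
  have hev : (fun y : E3 => W (-1) (L y + d + b)) =ᶠ[𝓝 (0 : E3)] fun y => L (W (-1) (y + b)) := by
    filter_upwards [isOpen_ball.mem_nhds (mem_ball_self ha)] with w hw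
    rw [add_comm (L w + d) b, add_comm w b]
    exact hsym w hw
  have heq := hf.eqOn_of_preconnected_of_eventuallyEq hg isPreconnected_univ (mem_univ 0) hev
  have hsym' : ∀ y : E3, (fun s y => W s (y + b)) (-1) (L y + d) = L ((fun s y => W s (y + b)) (-1) y) :=
    fun y => heq (mem_univ y)
  have hz := eq_zero_of_discreteScrew_slice hV.hasTypeITimeDecay hV.continuousOn_uncurry
    (fun s t hst ht x => hV.mild_eq_heatExtension hst ht x) (fun t ht => hV.isDivFree ht)
    (show (-1 : ℝ) < 0 by norm_num) L hd hfix hn hLn hsym'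
  intro s hs y
  have := hz s hs (y - b)
  simpa using this

end Summit.NavierStokesRegularity.NavierStokesRegularity.Theorems.ScenarioCensus.ScrewTop

end
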